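import Literature.MathematicalPhysics.QuantumFieldTheory.Balaban1983to89.T4CombHolderWindow

/-!
# `Balaban1983to89.T4CombHolderPairs` — GENERAL PAIRS for the lattice (sup, ∇, Hölder) window of a bond field on
# one block: the coordinate STAIRCASE from the axis-parallel Hölder slot of `T4CombHolderWindow.WindowData` to all
# pairs of interior stencils, with the constants of the four distance normalisations (cell row
# T4-O3.E-NE1′-OG1′-RESID-R3b*, node O3, estimate NE1′, located obligation O-G1′; residual (R3b) of GAPS G-pv24g11-1)

PRINTED (B9 = [Balaban1985BackgroundPropagators]):
* COPY (quotation certified in the header of `T4CombHolderWindow`, XREAD C-adv4-86; the prose — not the displayed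
  formulas, which the text layer garbles — re-confirmed by this seat on the held text
  `paper:balaban1985-cmp99-background-propagators`, PDF p. 9 = journal p. 397, lines 4–16): B9 p. 397 "To formulate
  the regularity and decay properties we have to introduce several norms. They are identical to the norms used in
  [3, 4], e.g., given by (1.108), (1.109), but the derivatives there have to be replaced by the corresponding
  covariant derivatives determined by a configuration U. Thus we have the supremum norms |A| = max_μ sup_x |A_μ(x)|,
  |∇A| = max_{μ,ν} sup_x |(D_μA_ν)(x)|, (3.39) and the Hölder norms ‖A‖_α = max_μ sup_{x,x′:|x−x′|≤1}
  (1/|x′ − x|^α)|R(U(Γ_{x,x′}))A_μ(x′) − A_μ(x)|, (3.40) ‖A‖_{1,α} = ‖∇A‖_α = max_{μ,ν} sup_{x,x′:|x−x′|≤1}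
  (1/|x′ − x|^α)|R(U(Γ_{x,x′}))(D_μA_ν)(x′) − (D_μA_ν)(x)|, where Γ_{x,x′} is a shortest contour connecting points
  x and x′. It is understood that the η-scale is used in the above definitions. If we use another scale, then it
  is indicated explicitly by a superscript"
  [cite: Balaban1985BackgroundPropagators, (3.39)–(3.40) p. 397]

HONEST FRAMING (cell `pub-balaban`, T4-DAG PAGE 1).  The cell's T4 target is the existence AND uniqueness of the
continuum limit of Bałaban's unit-scale averaged loop expectations on a FINITE four-torus, at rung (B)+1 of the cell's
ladder — CONDITIONAL on the perturbative β-function hypothesis BetaPertH and on the running-coupling hypotheses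
(B)/(B^μ) wherever a consumer uses them (none is used IN this file); it is NOT an infinite-volume statement, NOT the
Yang–Mills mass gap and NOT the Clay problem.  NO statement about Bałaban's renormalization-group objects is asserted:
the window data below is a HYPOTHESIS SHAPE on an abstract `R`-valued bond field, re-read by elementary bookkeeping.

THE QUESTION LEFT (GAPS G-pv24g11-1, residual (R3b), verbatim): "(R3b) GENERAL PAIRS ∣x − x′∣ ≤ 1 (η-scale, i.e. up
to L^j… lattice steps inside a big block) and shortest contours vs the axis-parallel x′ = x + m·e_ρ of
`WindowData.hol`: a staircase decomposition gives the general pair from d axis-parallel legs at the cost of a factor d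
and the transported corner terms — not typed".  Upstream state: `T4CombHolderWindow.WindowData L z β D b` records, in
its Hölder field (iii), the `β`-quotients of the PLAIN first differences `(∂_μD)(x;ν) = fdiff D μ x ν` for
AXIS-PARALLEL pairs `x, x + m·e_ρ` of interior stencils only (its HONEST SCOPE (b): "Hölder pairs are AXIS-PARALLEL
(`x′ = x + m·e_ρ`) inside one block, distances counted in lattice STEPS `m` (print: all pairs `|x − x′| ≤ 1` in the
η-scale, shortest contours)").

WHAT THIS FILE DOES ([folklore] lattice bookkeeping and real arithmetic on the EXISTING `WindowData`; no analytic
input, no new hypothesis shape).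
§1 coordinate mixing `mix s x x′` (the corners of the coordinate box spanned by two sites: coordinate `x′_κ` for
   `κ ∈ s`, `x_κ` otherwise; `mix ∅ = x`, `mix univ = x′`), the staircase step `mix (insert ρ s) = mix s ± m·e_ρ`
   with `m = |x′_ρ − x_ρ|` (`mix_insert_of_le`, `mix_insert_of_ge`), translation `mix s (x+v) (x′+v) = mix s x x′ +
   v`, and box-convexity of the corner block under mixing (`inBlock_mix`).
§2 THE STAIRCASE LEMMA `norm_sub_le_of_legs`: for any `F : Site d → M` (`M` a seminormed group) and any site
   predicate `P` holding at every corner `mix s x x′`, axis-leg bounds `‖F(w + m·e_ρ) − F(w)‖ ≤ c·m^β` between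
   `P`-sites give `‖F x′ − F x‖ ≤ c·Σ_κ |x′_κ − x_κ|^β` — `d` legs, one per coordinate, each leg oriented from its
   smaller `ρ`-coordinate so that the `m : ℕ` form applies (`norm_step_le`), summed by the triangle inequality;
   the converse bookkeeping `sum_abs_rpow_axis` / `axis_of_pairs` (at `x′ = x + m·e_ρ`, `0 < β`, the coordinate sum
   IS `m^β`, so a general-pair bound in the coordinate-sum format restricts back to the axis-parallel format with
   the SAME constant); (arith) the power-mean / concavity inequalities `sum_rpow_le_card_rpow_mul_sum_rpow`
   (`Σ_{i∈s} a_i^β ≤ (#s)^{1−β}·(Σ_{i∈s} a_i)^β`, `a_i ≥ 0`, `0 ≤ β ≤ 1`; Jensen for `Real.concaveOn_rpow`) and its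
   Euclidean form `sum_abs_rpow_le_card_rpow_mul_sum_sq_rpow` (`Σ_{i∈s} |a_i|^β ≤ (#s)^{1−β/2}·(Σ_{i∈s} a_i²)^{β/2}`,
   `0 ≤ β ≤ 2`); a NON-DEGENERATE witness of the staircase lemma (the first-coordinate function: the bound is attained).
§3 the interior-STENCIL predicate `StencilIn L z μ ν x` (:= the three interiority hypotheses `x, x+e_μ, x+e_μ+e_ν ∈
   B(z)` under which `WindowData.grad` / `.hol` speak of `(∂_μD)(x;ν)`) and the interior-BOND predicate `BondIn L z
   ν y` (`y, y+e_ν ∈ B(z)`); both are coordinate boxes, hence closed under mixing (`stencilIn_mix`, `bondIn_mix`):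
   the staircase between two interior stencils / bonds STAYS interior; bonds along an axis segment
   (`bondIn_add_nsmul_of_le`); an interior stencil carries the two interior bonds `⟨x,x+e_ν⟩`, `⟨x+e_μ,x+e_μ+e_ν⟩`
   (`StencilIn.bondIn`); the corner stencil / bond is interior for `3 ≤ L` / `2 ≤ L` (`stencilIn_corner`,
   `bondIn_corner`).
§4 GENERAL PAIRS FOR THE HÖLDER SLOT: `hol_pair` — `WindowData L z β D b` gives, for EVERY pair of interior
   stencils `x, x′` in `B(z)`, `‖(∂_μD)(x′;ν) − (∂_μD)(x;ν)‖ ≤ b₂·Σ_κ |x′_κ − x_κ|^β` with the SAME constant `b₂ =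
   b.hol` (no loss in the coordinate-sum normalisation); the two readings `hol_pair_linf` (`≤ d·b₂·r^β` whenever
   `|x′_κ − x_κ| ≤ r` for all `κ`, `0 ≤ β` — the «factor d» of the GAPS text) and `hol_pair_l1` (`≤
   d^{1−β}·b₂·ℓ₁(x,x′)^β` with `ℓ₁(x,x′) = Σ_κ|x′_κ − x_κ|` = the number of steps of a shortest LATTICE contour from
   `x` to `x′`, `0 ≤ β ≤ 1`, by concavity of `t ↦ t^β`), the EUCLIDEAN reading `hol_pair_l2` (`≤
   d^{1−β/2}·b₂·ℓ₂(x,x′)^β`, `ℓ₂(x,x′)^β = (Σ_κ (x′_κ − x_κ)²)^{β/2}`, `0 ≤ β ≤ 2` — print's `|x′ − x|^α` read as the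
   Euclidean distance in lattice steps); and the consistency check `hol_axis_of_pair`: at
   `x′ = x + m·e_ρ` (`0 < β`) the general-pair format restricts back to the axis-parallel format of
   `WindowData.hol` with the same constant — on one block the two formats are EQUIVALENT, and the only price of a
   general pair is the normalisation constant `1` / `d` / `d^{1−β}` of the chosen distance, recorded here.
§5 GENERAL PAIRS FOR THE GRADIENT SLOT: `grad_leg` (telescoping along an axis segment of interior bonds:
   `‖D(y + m·e_μ;ν) − D(y;ν)‖ ≤ b₁·m`), `grad_pair` (`≤ b₁·ℓ₁(y,y′)` for every pair of interior bonds `⟨y,y+e_ν⟩,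
   ⟨y′,y′+e_ν⟩`, by the staircase lemma with `β = 1`), its Euclidean reading `grad_pair_l2` (`≤ √d·b₁·ℓ₂(y,y′)`,
   Cauchy–Schwarz as the case `β = 1` of the Euclidean power mean) and the interpolated Hölder reading of the field itself
   `sup_grad_pair` (`≤ (2b₀)^{1−γ}·(b₁·ℓ₁(y,y′))^γ`, `0 ≤ γ ≤ 1`, via `T4RelativeCombGradient.min_le_rpow_mul_rpow`)
   — the plain-difference format, on general pairs, of print's FIRST Hölder norm `‖A‖_α` of (3.40).
§6 non-vacuity: the zero field with window `(0,0,0)` (`T4CombHolderWindow.windowData_zero`) between two corner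
   stencils inhabits `hol_pair`; a two-dimensional staircase is computed.

HONEST SCOPE / NOT CLAIMED.  (a) PLAIN lattice differences of `R`-valued bond variables exactly as in
`T4CombHolderWindow`: NO parallel transport `R(U(Γ_{x,x′}))`, NO covariant derivative — the "transported corner terms"
of the GAPS text belong to residual (R3a) (covariant / transported quotients; G-pv24g11-1: "(R3a)/(R3b) are design
decisions that should be taken together with the first CONSUMER that needs the covariant form"), which is NOT touched;
for plain differences the staircase is EXACT bookkeeping (a telescoping sum has no corner terms), so NOTHING of (R3a)
is discharged here; (b) the η ↔ L^jη ↔ lattice-step dictionary (residual (R3d)) is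
NOT touched: distances are counted in lattice STEPS, coordinate by coordinate, and WHICH normalisation a consumer wants
(coordinate sum `Σ_κ|·|^β`, `ℓ^∞`, `ℓ¹` = lattice contour length; print: `|x′ − x|` in the η-scale over pairs `|x − x′|
≤ 1`) is left to the consumer — all four are recorded with their constants (`1` coordinate sum, `d` for `ℓ^∞`,
`d^{1−β}` for `ℓ¹`, `d^{1−β/2}` for the Euclidean `ℓ²`; for the gradient slot `1` for `ℓ¹`, `√d` for `ℓ²`); (c) ONE corner-anchored block `B(z)`, interior stencils /
bonds only; nothing across blocks, no window `K`, no second differences (residual (R3c), pv24 lineage); (d) nothing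
about Bałaban's configurations, gauges, averaging or renormalization transformations, or the validity of any window
for them, is asserted — `WindowData` is a hypothesis SHAPE and this file only re-reads it; no consumer of the T4 chain
is changed; (e) NOT summit progress: rung (B)+1 bookkeeping on a FINITE torus ≠ infinite volume / mass gap / Clay.

LABELS.  [printed] = quoted above (COPY); [folklore] = elementary lattice bookkeeping / real arithmetic on abstract
data.  IMPORTS BY NAME ONLY (one-writer files of other lineages are never edited): `T4CombHolderWindow` (pv24: `Site`,
`add_e_apply`, `add_nsmul_e_apply`, `add_nsmul_add_comm`, `add_succ_nsmul`, `inBlock_add_of_add_add`,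
`inBlock_add_nsmul_of_le`, `fdiff`, `Win`, `WindowData`, `windowData_zero`), `T4RelativeCombGradient` (pv24: `min_le_rpow_mul_rpow`), `T4BlockTransport`
(t4-ne1p-p1: `Fld`), `B8Lemma1Lattice` (`e`, `InBlock`); Mathlib (`Real.concaveOn_rpow`, `ConcaveOn.le_map_sum`).

VERSIONS.  v1 = p187283 (commit 5fa6d0ada375; XREAD PASS C-pv10-86).  v1.1 = APPEND + DOCFIX over v1 (every v1
declaration kept with its statement and proof; added: `sum_abs_rpow_le_card_rpow_mul_sum_sq_rpow`, `hol_pair_l2`,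
`grad_pair_l2`, one non-degenerate staircase `example`; docstring changes: title "four" normalisations, §2/§4/§5
entries, HONEST SCOPE (b), and the (R3a) sentence above now quotes GAPS G-pv24g11-1 verbatim instead of a
paraphrase in quotation marks — XREAD C-pv10-86 remarks R1/R2).
-/

namespace Literature.MathematicalPhysics.QuantumFieldTheory.Balaban1983to89.T4CombHolderPairs

open B8Lemma1Lattice (e InBlock)
open T4BlockTransport (Fld)
open T4RelativeCombGradient (min_le_rpow_mul_rpow)
open T4CombHolderWindow (add_e_apply add_nsmul_e_apply add_nsmul_add_comm add_succ_nsmul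
  inBlock_add_nsmul_of_le fdiff fdiff_apply Win WindowData windowData_zero)

variable {R : Type*} [NormedRing R] {d : ℕ}

/-- [folklore] Sites of `ℤ^d` — the SAME carrier as `B8Lemma1Lattice.Site d` / `T4BlockTransport.Site d` /
`T4CombHolderWindow.Site d` (definitionally; re-declared here only so that the bare name is not captured by an
ancestor namespace). -/
abbrev Site (d : ℕ) : Type := Fin d → ℤ

example (d : ℕ) : Site d = T4CombHolderWindow.Site d := rfl

/-! ## §1  Coordinate mixing of two sites; the staircase step; box-convexity of the block under mixing -/

section Mix

/-- [folklore] COORDINATE MIXING of two sites: the site whose `κ`-th coordinate is `x′_κ` for `κ ∈ s` and `x_κ`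
otherwise — the corners of the coordinate box spanned by `x` and `x′` (`s = ∅` gives `x`, `s = univ` gives `x′`). -/
def mix (s : Finset (Fin d)) (x x' : Site d) : Site d := fun κ => if κ ∈ s then x' κ else x κ

/-- [folklore] `mix` evaluates by its defining formula. -/
@[simp] theorem mix_apply (s : Finset (Fin d)) (x x' : Site d) (κ : Fin d) :
    mix s x x' κ = if κ ∈ s then x' κ else x κ := rfl

/-- [folklore] No coordinate mixed: `x`. -/
@[simp] theorem mix_empty (x x' : Site d) : mix ∅ x x' = x := by
  ext κ; simp

/-- [folklore] All coordinates mixed: `x′`. -/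
@[simp] theorem mix_univ (x x' : Site d) : mix Finset.univ x x' = x' := by
  ext κ; simp

/-- [folklore] Mixing commutes with a common translation. -/
theorem mix_add_right (s : Finset (Fin d)) (x x' v : Site d) : mix s (x + v) (x' + v) = mix s x x' + v := by
  ext κ; by_cases h : κ ∈ s <;> simp [h]

/-- [folklore] THE STAIRCASE STEP, increasing leg: if `x_ρ ≤ x′_ρ` and `ρ ∉ s`, mixing one more coordinate `ρ`
moves the corner by `m·e_ρ` with `m = x′_ρ − x_ρ ∈ ℕ`. -/
theorem mix_insert_of_le {s : Finset (Fin d)} {ρ : Fin d} (hρ : ρ ∉ s) {x x' : Site d} (h : x ρ ≤ x' ρ) :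
    mix (insert ρ s) x x' = mix s x x' + (x' ρ - x ρ).toNat • e ρ := by
  ext κ
  rw [add_nsmul_e_apply, Int.toNat_of_nonneg (sub_nonneg.mpr h)]
  by_cases hκ : κ = ρ
  · subst hκ; simp [hρ]
  · simp [hκ]

/-- [folklore] THE STAIRCASE STEP, decreasing leg: if `x′_ρ ≤ x_ρ` and `ρ ∉ s`, the OLD corner is the new one
moved by `m·e_ρ` with `m = x_ρ − x′_ρ ∈ ℕ` (so the axis-parallel `m : ℕ` format applies with the roles swapped). -/
theorem mix_insert_of_ge {s : Finset (Fin d)} {ρ : Fin d} (hρ : ρ ∉ s) {x x' : Site d} (h : x' ρ ≤ x ρ) :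
    mix s x x' = mix (insert ρ s) x x' + (x ρ - x' ρ).toNat • e ρ := by
  ext κ
  rw [add_nsmul_e_apply, Int.toNat_of_nonneg (sub_nonneg.mpr h)]
  by_cases hκ : κ = ρ
  · subst hκ; simp [hρ]
  · simp [hκ]

/-- [folklore] BOX-CONVEXITY of the corner-anchored block `B(z) = {x : z_κ ≤ x_κ < z_κ + L ∀κ}` under coordinate
mixing: every corner of the coordinate box of two block sites is a block site. -/
theorem inBlock_mix {L : ℕ} {z x x' : Site d} (hx : InBlock L z x) (hx' : InBlock L z x') (s : Finset (Fin d)) :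
    InBlock L z (mix s x x') := by
  intro κ
  by_cases h : κ ∈ s
  · simpa [h] using hx' κ
  · simpa [h] using hx κ

end Mix

/-! ## §2  The staircase lemma: axis-parallel leg bounds give general-pair bounds in the coordinate-sum format -/

section Staircase

variable {M : Type*} [SeminormedAddCommGroup M]

/-- [folklore] ONE LEG of the staircase: under axis-leg bounds `‖F(w + m·e_ρ) − F(w)‖ ≤ c·m^β` between `P`-sites
and `P` at every corner, mixing one more coordinate `ρ ∉ s` costs `c·|x′_ρ − x_ρ|^β` (the leg is read in the
direction of increasing `ρ`-coordinate; `‖a − b‖ = ‖b − a‖`). -/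
theorem norm_step_le (F : Site d → M) (P : Site d → Prop) {c β : ℝ} {x x' : Site d} (hP : ∀ s, P (mix s x x'))
    (hleg : ∀ (w : Site d) (ρ : Fin d) (m : ℕ), P w → P (w + m • e ρ) →
      ‖F (w + m • e ρ) - F w‖ ≤ c * (m : ℝ) ^ β)
    {s : Finset (Fin d)} {ρ : Fin d} (hρ : ρ ∉ s) :
    ‖F (mix (insert ρ s) x x') - F (mix s x x')‖ ≤ c * |(x' ρ : ℝ) - x ρ| ^ β := by
  rcases le_total (x ρ) (x' ρ) with h | h
  · have hm : (((x' ρ - x ρ).toNat : ℕ) : ℝ) = |(x' ρ : ℝ) - x ρ| := by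
      have h1 : (((x' ρ - x ρ).toNat : ℕ) : ℤ) = x' ρ - x ρ := Int.toNat_of_nonneg (sub_nonneg.mpr h)
      have h2 : (x ρ : ℝ) ≤ x' ρ := by exact_mod_cast h
      rw [abs_of_nonneg (sub_nonneg.mpr h2)]
      exact_mod_cast h1
    have key := hleg (mix s x x') ρ (x' ρ - x ρ).toNat (hP s) (by rw [← mix_insert_of_le hρ h]; exact hP _)
    rwa [← mix_insert_of_le hρ h, hm] at key
  · have hm : (((x ρ - x' ρ).toNat : ℕ) : ℝ) = |(x' ρ : ℝ) - x ρ| := by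
      have h1 : (((x ρ - x' ρ).toNat : ℕ) : ℤ) = x ρ - x' ρ := Int.toNat_of_nonneg (sub_nonneg.mpr h)
      have h2 : (x' ρ : ℝ) ≤ x ρ := by exact_mod_cast h
      rw [abs_of_nonpos (sub_nonpos.mpr h2), neg_sub]
      exact_mod_cast h1
    have key := hleg (mix (insert ρ s) x x') ρ (x ρ - x' ρ).toNat (hP _)
      (by rw [← mix_insert_of_ge hρ h]; exact hP s)
    rw [← mix_insert_of_ge hρ h, hm, norm_sub_rev] at key
    exact key

/-- [folklore] THE STAIRCASE LEMMA.  Let `F : Site d → M` and let `P` be a site predicate holding at every corner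
`mix s x x′` of the coordinate box of `x, x′` (e.g. a coordinate box containing `x` and `x′`).  If
`‖F(w + m·e_ρ) − F(w)‖ ≤ c·m^β` for all AXIS-PARALLEL pairs of `P`-sites, then
`‖F x′ − F x‖ ≤ c · Σ_κ |x′_κ − x_κ|^β` — the general pair from `d` axis-parallel legs. -/
theorem norm_sub_le_of_legs (F : Site d → M) (P : Site d → Prop) {c β : ℝ} {x x' : Site d}
    (hP : ∀ s, P (mix s x x'))
    (hleg : ∀ (w : Site d) (ρ : Fin d) (m : ℕ), P w → P (w + m • e ρ) →
      ‖F (w + m • e ρ) - F w‖ ≤ c * (m : ℝ) ^ β) :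
    ‖F x' - F x‖ ≤ c * ∑ κ, |(x' κ : ℝ) - x κ| ^ β := by
  classical
  suffices H : ∀ s : Finset (Fin d), ‖F (mix s x x') - F x‖ ≤ c * ∑ κ ∈ s, |(x' κ : ℝ) - x κ| ^ β by
    simpa using H Finset.univ
  intro s
  induction s using Finset.induction_on with
  | empty => simp
  | insert ρ s hρ ih =>
    rw [Finset.sum_insert hρ, mul_add]
    calc ‖F (mix (insert ρ s) x x') - F x‖
        ≤ ‖F (mix (insert ρ s) x x') - F (mix s x x')‖ + ‖F (mix s x x') - F x‖ :=
          norm_sub_le_norm_sub_add_norm_sub _ _ _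
      _ ≤ c * |(x' ρ : ℝ) - x ρ| ^ β + c * ∑ κ ∈ s, |(x' κ : ℝ) - x κ| ^ β :=
          add_le_add (norm_step_le F P hP hleg hρ) ih

/-- [folklore] (arith) At an AXIS-PARALLEL pair the coordinate sum IS the axis-parallel weight: for `0 < β`,
`Σ_κ |(x + m·e_ρ)_κ − x_κ|^β = m^β` (the untouched coordinates contribute `0^β = 0`). -/
theorem sum_abs_rpow_axis {β : ℝ} (hβ : 0 < β) (x : Site d) (ρ : Fin d) (m : ℕ) :
    ∑ κ, |((x + m • e ρ) κ : ℝ) - x κ| ^ β = (m : ℝ) ^ β := by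
  rw [Finset.sum_eq_single ρ]
  · rw [add_nsmul_e_apply, if_pos rfl]; push_cast; simp
  · intro κ _ hκ
    rw [add_nsmul_e_apply, if_neg hκ, add_zero, sub_self, abs_zero, Real.zero_rpow hβ.ne']
  · intro h; exact absurd (Finset.mem_univ ρ) h

/-- [folklore] CONSISTENCY (the converse direction): a general-pair bound in the coordinate-sum format with constant
`c` restricts, at `x′ = x + m·e_ρ`, to the axis-parallel bound with the SAME constant (`0 < β`) — so on one block the
axis-parallel format of `WindowData.hol` and the general-pair format of `hol_pair` are equivalent. -/
theorem axis_of_pairs (F : Site d → M) (P : Site d → Prop) {c β : ℝ} (hβ : 0 < β)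
    (hpair : ∀ x x', P x → P x' → ‖F x' - F x‖ ≤ c * ∑ κ, |(x' κ : ℝ) - x κ| ^ β)
    (w : Site d) (ρ : Fin d) (m : ℕ) (hw : P w) (hwm : P (w + m • e ρ)) :
    ‖F (w + m • e ρ) - F w‖ ≤ c * (m : ℝ) ^ β := by
  have h := hpair w (w + m • e ρ) hw hwm
  rwa [sum_abs_rpow_axis hβ] at h

/-- [folklore] (arith) CONCAVITY of `t ↦ t^β` (`0 ≤ β ≤ 1`) in power-mean form: `Σ_{i∈s} a_i^β ≤
(#s)^{1−β}·(Σ_{i∈s} a_i)^β` for `a_i ≥ 0` (Jensen, `Real.concaveOn_rpow`, with equal weights). -/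
theorem sum_rpow_le_card_rpow_mul_sum_rpow {ι : Type*} (s : Finset ι) (a : ι → ℝ) {β : ℝ}
    (ha : ∀ i ∈ s, 0 ≤ a i) (hβ0 : 0 ≤ β) (hβ1 : β ≤ 1) :
    ∑ i ∈ s, a i ^ β ≤ (s.card : ℝ) ^ (1 - β) * (∑ i ∈ s, a i) ^ β := by
  rcases s.eq_empty_or_nonempty with rfl | hne
  · simp only [Finset.sum_empty, Finset.card_empty, Nat.cast_zero]
    positivity
  have hn : (0 : ℝ) < s.card := by exact_mod_cast hne.card_pos
  have hsum : 0 ≤ ∑ i ∈ s, a i := Finset.sum_nonneg ha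
  have J := (Real.concaveOn_rpow hβ0 hβ1).le_map_sum (t := s) (w := fun _ => (s.card : ℝ)⁻¹) (p := a)
    (fun _ _ => inv_nonneg.mpr hn.le)
    (by rw [Finset.sum_const, nsmul_eq_mul, mul_inv_cancel₀ hn.ne'])
    (fun i hi => Set.mem_Ici.mpr (ha i hi))
  simp only [smul_eq_mul, ← Finset.mul_sum] at J
  rw [Real.mul_rpow (inv_nonneg.mpr hn.le) hsum] at J
  have hn1 : (s.card : ℝ) ^ (1 - β) = s.card * (s.card : ℝ)⁻¹ ^ β := by
    rw [Real.inv_rpow hn.le, Real.rpow_sub hn, Real.rpow_one, div_eq_mul_inv]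
  calc ∑ i ∈ s, a i ^ β = s.card * ((s.card : ℝ)⁻¹ * ∑ i ∈ s, a i ^ β) := by
        rw [← mul_assoc, mul_inv_cancel₀ hn.ne', one_mul]
    _ ≤ s.card * ((s.card : ℝ)⁻¹ ^ β * (∑ i ∈ s, a i) ^ β) := mul_le_mul_of_nonneg_left J hn.le
    _ = (s.card : ℝ) ^ (1 - β) * (∑ i ∈ s, a i) ^ β := by rw [hn1, mul_assoc]

/-- [folklore] (arith) THE EUCLIDEAN POWER MEAN: `Σ_{i∈s} |a_i|^β ≤ (#s)^{1−β/2} · (Σ_{i∈s} a_i²)^{β/2}` for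
`0 ≤ β ≤ 2` (the previous inequality for `t ↦ t^{β/2}` at `a_i²`, and `(a²)^{β/2} = |a|^β`). -/
theorem sum_abs_rpow_le_card_rpow_mul_sum_sq_rpow {ι : Type*} (s : Finset ι) (a : ι → ℝ) {β : ℝ}
    (hβ0 : 0 ≤ β) (hβ2 : β ≤ 2) :
    ∑ i ∈ s, |a i| ^ β ≤ (s.card : ℝ) ^ (1 - β / 2) * (∑ i ∈ s, a i ^ 2) ^ (β / 2) := by
  have H := sum_rpow_le_card_rpow_mul_sum_rpow s (fun i => a i ^ 2) (β := β / 2) (fun i _ => sq_nonneg (a i))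
    (by linarith) (by linarith)
  have key : ∀ i, (a i ^ 2) ^ (β / 2) = |a i| ^ β := fun i => by
    rw [← sq_abs, ← Real.rpow_natCast |a i| 2, ← Real.rpow_mul (abs_nonneg _)]
    congr 1
    push_cast
    ring
  simpa only [key] using H

/-- A NON-DEGENERATE witness of the staircase lemma: for the first-coordinate function `F x = x₀` (all sites
admissible, `c = 1`, `β = 1`) the axis legs are `‖(w + m·e_ρ)₀ − w₀‖ = m·[ρ = 0] ≤ m`, and the conclusion
`|x′₀ − x₀| ≤ Σ_κ |x′_κ − x_κ|` is ATTAINED whenever `x, x′` differ in the first coordinate only. -/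
example (x x' : Site (d + 1)) : ‖((x' 0 : ℤ) : ℝ) - ((x 0 : ℤ) : ℝ)‖ ≤ 1 * ∑ κ, |(x' κ : ℝ) - x κ| ^ (1 : ℝ) := by
  refine norm_sub_le_of_legs (fun y : Site (d + 1) => ((y 0 : ℤ) : ℝ)) (fun _ => True) (fun _ => trivial) ?_
  intro w ρ m _ _
  rw [Real.rpow_one, one_mul, add_nsmul_e_apply, Real.norm_eq_abs]
  split_ifs
  · push_cast; rw [add_sub_cancel_left, Nat.abs_cast]
  · push_cast; rw [add_zero, sub_self, abs_zero]; positivity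

end Staircase

/-! ## §3  Interior stencils and interior bonds are coordinate boxes: the staircase stays interior -/

section Boxes

variable {L : ℕ} {z : Site d}

/-- [folklore] INTERIOR STENCIL at `x` for the directions `(μ, ν)`: the three sites `x`, `x + e_μ`, `x + e_μ + e_ν`
lie in the corner block `B(z)` — exactly the interiority hypotheses under which `T4CombHolderWindow.WindowData.grad`
and `.hol` speak of the first difference `(∂_μD)(x;ν)` (by convexity `x + e_ν ∈ B(z)` too,
`T4CombHolderWindow.inBlock_add_of_add_add`).  As a set of `x` it is the coordinate box `z_κ ≤ x_κ ≤ z_κ + L − 1 −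
[κ = μ] − [κ = ν]`. -/
def StencilIn (L : ℕ) (z : Site d) (μ ν : Fin d) (x : Site d) : Prop :=
  InBlock L z x ∧ InBlock L z (x + e μ) ∧ InBlock L z (x + e μ + e ν)

/-- [folklore] INTERIOR BOND `⟨y, y + e_ν⟩`: both endpoints lie in `B(z)`. -/
def BondIn (L : ℕ) (z : Site d) (ν : Fin d) (y : Site d) : Prop := InBlock L z y ∧ InBlock L z (y + e ν)

/-- [folklore] Interior stencils form a coordinate box: closed under coordinate mixing. -/
theorem stencilIn_mix {μ ν : Fin d} {x x' : Site d} (hx : StencilIn L z μ ν x) (hx' : StencilIn L z μ ν x')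
    (s : Finset (Fin d)) : StencilIn L z μ ν (mix s x x') := by
  refine ⟨inBlock_mix hx.1 hx'.1 s, ?_, ?_⟩
  · rw [← mix_add_right]; exact inBlock_mix hx.2.1 hx'.2.1 s
  · rw [← mix_add_right, ← mix_add_right]; exact inBlock_mix hx.2.2 hx'.2.2 s

/-- [folklore] Interior bonds (fixed direction `ν`) form a coordinate box: closed under coordinate mixing. -/
theorem bondIn_mix {ν : Fin d} {y y' : Site d} (hy : BondIn L z ν y) (hy' : BondIn L z ν y')
    (s : Finset (Fin d)) : BondIn L z ν (mix s y y') := by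
  refine ⟨inBlock_mix hy.1 hy'.1 s, ?_⟩
  rw [← mix_add_right]; exact inBlock_mix hy.2 hy'.2 s

/-- [folklore] Interior bonds along an axis segment: if `⟨y, y+e_ν⟩` and `⟨y + m·e_μ, y + m·e_μ + e_ν⟩` are interior
then so is every `⟨y + i·e_μ, y + i·e_μ + e_ν⟩`, `i ≤ m`. -/
theorem bondIn_add_nsmul_of_le {ν μ : Fin d} {y : Site d} {m i : ℕ} (hy : BondIn L z ν y)
    (hym : BondIn L z ν (y + m • e μ)) (hi : i ≤ m) : BondIn L z ν (y + i • e μ) := by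
  refine ⟨inBlock_add_nsmul_of_le hy.1 hym.1 hi, ?_⟩
  have h2 := hym.2
  rw [add_nsmul_add_comm] at h2 ⊢
  exact inBlock_add_nsmul_of_le hy.2 h2 hi

/-- [folklore] An interior stencil determines the interior bonds `⟨x, x+e_ν⟩` and `⟨x+e_μ, x+e_μ+e_ν⟩`. -/
theorem StencilIn.bondIn {μ ν : Fin d} {x : Site d} (hx : StencilIn L z μ ν x) :
    BondIn L z ν x ∧ BondIn L z ν (x + e μ) :=
  ⟨⟨hx.1, T4CombHolderWindow.inBlock_add_of_add_add hx.1 hx.2.2⟩, ⟨hx.2.1, hx.2.2⟩⟩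

/-- [folklore] Non-vacuity: the corner stencil is interior as soon as `3 ≤ L`. -/
theorem stencilIn_corner (hL : 3 ≤ L) (z : Site d) (μ ν : Fin d) : StencilIn L z μ ν z := by
  refine ⟨fun κ => ⟨le_rfl, by omega⟩, fun κ => ?_, fun κ => ?_⟩
  · rw [add_e_apply]; split_ifs <;> constructor <;> omega
  · rw [add_e_apply, add_e_apply]; split_ifs <;> constructor <;> omega

/-- [folklore] Non-vacuity: the corner bond is interior as soon as `2 ≤ L`. -/
theorem bondIn_corner (hL : 2 ≤ L) (z : Site d) (ν : Fin d) : BondIn L z ν z := by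
  refine ⟨fun κ => ⟨le_rfl, by omega⟩, fun κ => ?_⟩
  rw [add_e_apply]; split_ifs <;> constructor <;> omega

end Boxes

/-! ## §4  General pairs for the Hölder slot of `WindowData`, with the constants of three normalisations -/

section Holder

variable {L : ℕ} {z : Site d} {β : ℝ} {D : Fld d R} {b : Win}

/-- [folklore] GENERAL PAIRS FOR THE HÖLDER SLOT (residual (R3b), plain-difference format).  Window data on `B(z)`
give, for EVERY pair of interior stencils `x, x′` (no axis-parallel restriction, any lattice distance inside the
block), `‖(∂_μD)(x′;ν) − (∂_μD)(x;ν)‖ ≤ b₂ · Σ_κ |x′_κ − x_κ|^β` with the SAME Hölder constant `b₂ = b.hol`: the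
staircase lemma applied to `x ↦ (∂_μD)(x;ν)` on the box of interior stencils, each leg being an instance of
`WindowData.hol`.  HONEST: plain differences — no transport along `Γ_{x,x′}` (residual (R3a) untouched). -/
theorem hol_pair (h : WindowData L z β D b) {μ ν : Fin d} {x x' : Site d} (hx : StencilIn L z μ ν x)
    (hx' : StencilIn L z μ ν x') :
    ‖fdiff D μ x' ν - fdiff D μ x ν‖ ≤ b.hol * ∑ κ, |(x' κ : ℝ) - x κ| ^ β :=
  norm_sub_le_of_legs (fun y => fdiff D μ y ν) (StencilIn L z μ ν) (stencilIn_mix hx hx')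
    fun w ρ m hw hw' => h.hol μ ν ρ w m hw.1 hw.2.1 hw.2.2 hw'.1 hw'.2.1 hw'.2.2

/-- [folklore] THE ℓ^∞ READING («at the cost of a factor d»): if every coordinate of `x′ − x` is at most `r` in
absolute value then `‖(∂_μD)(x′;ν) − (∂_μD)(x;ν)‖ ≤ d · b₂ · r^β` (`0 ≤ β`). -/
theorem hol_pair_linf (h : WindowData L z β D b) (hβ : 0 ≤ β) {μ ν : Fin d} {x x' : Site d}
    (hx : StencilIn L z μ ν x) (hx' : StencilIn L z μ ν x') {r : ℝ} (hr : ∀ κ, |(x' κ : ℝ) - x κ| ≤ r) :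
    ‖fdiff D μ x' ν - fdiff D μ x ν‖ ≤ (d : ℝ) * b.hol * r ^ β := by
  refine (hol_pair h hx hx').trans ?_
  calc b.hol * ∑ κ, |(x' κ : ℝ) - x κ| ^ β ≤ b.hol * ∑ _κ : Fin d, r ^ β :=
        mul_le_mul_of_nonneg_left
          (Finset.sum_le_sum fun κ _ => Real.rpow_le_rpow (abs_nonneg _) (hr κ) hβ) h.hol_nonneg
    _ = (d : ℝ) * b.hol * r ^ β := by
        rw [Finset.sum_const, Finset.card_univ, Fintype.card_fin, nsmul_eq_mul]; ring

/-- [folklore] THE ℓ¹ / CONTOUR-LENGTH READING: with `ℓ₁(x,x′) = Σ_κ |x′_κ − x_κ|` (the number of steps of a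
shortest lattice contour from `x` to `x′`), `‖(∂_μD)(x′;ν) − (∂_μD)(x;ν)‖ ≤ d^{1−β} · b₂ · ℓ₁(x,x′)^β`
(`0 ≤ β ≤ 1`; concavity of `t ↦ t^β`). -/
theorem hol_pair_l1 (h : WindowData L z β D b) (hβ0 : 0 ≤ β) (hβ1 : β ≤ 1) {μ ν : Fin d} {x x' : Site d}
    (hx : StencilIn L z μ ν x) (hx' : StencilIn L z μ ν x') :
    ‖fdiff D μ x' ν - fdiff D μ x ν‖ ≤ (d : ℝ) ^ (1 - β) * b.hol * (∑ κ, |(x' κ : ℝ) - x κ|) ^ β := by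
  refine (hol_pair h hx hx').trans ?_
  have H := sum_rpow_le_card_rpow_mul_sum_rpow (Finset.univ : Finset (Fin d)) (fun κ => |(x' κ : ℝ) - x κ|)
    (fun _ _ => abs_nonneg _) hβ0 hβ1
  rw [Finset.card_univ, Fintype.card_fin] at H
  calc b.hol * ∑ κ, |(x' κ : ℝ) - x κ| ^ β ≤ b.hol * ((d : ℝ) ^ (1 - β) * (∑ κ, |(x' κ : ℝ) - x κ|) ^ β) :=
        mul_le_mul_of_nonneg_left H h.hol_nonneg
    _ = (d : ℝ) ^ (1 - β) * b.hol * (∑ κ, |(x' κ : ℝ) - x κ|) ^ β := by ring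

/-- [folklore] THE EUCLIDEAN READING: with `ℓ₂(x,x′)² = Σ_κ (x′_κ − x_κ)²` (Euclidean distance in lattice steps),
`‖(∂_μD)(x′;ν) − (∂_μD)(x;ν)‖ ≤ d^{1−β/2} · b₂ · (ℓ₂(x,x′)²)^{β/2}` (`0 ≤ β ≤ 2`; Euclidean power mean). -/
theorem hol_pair_l2 (h : WindowData L z β D b) (hβ0 : 0 ≤ β) (hβ2 : β ≤ 2) {μ ν : Fin d} {x x' : Site d}
    (hx : StencilIn L z μ ν x) (hx' : StencilIn L z μ ν x') :
    ‖fdiff D μ x' ν - fdiff D μ x ν‖ ≤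
      (d : ℝ) ^ (1 - β / 2) * b.hol * (∑ κ, ((x' κ : ℝ) - x κ) ^ 2) ^ (β / 2) := by
  refine (hol_pair h hx hx').trans ?_
  have H := sum_abs_rpow_le_card_rpow_mul_sum_sq_rpow (Finset.univ : Finset (Fin d)) (fun κ => (x' κ : ℝ) - x κ)
    hβ0 hβ2
  rw [Finset.card_univ, Fintype.card_fin] at H
  calc b.hol * ∑ κ, |(x' κ : ℝ) - x κ| ^ β
      ≤ b.hol * ((d : ℝ) ^ (1 - β / 2) * (∑ κ, ((x' κ : ℝ) - x κ) ^ 2) ^ (β / 2)) :=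
        mul_le_mul_of_nonneg_left H h.hol_nonneg
    _ = (d : ℝ) ^ (1 - β / 2) * b.hol * (∑ κ, ((x' κ : ℝ) - x κ) ^ 2) ^ (β / 2) := by ring

/-- [folklore] CONSISTENCY: the general-pair format of `hol_pair` restricts, at an axis-parallel pair of interior
stencils, to the axis-parallel format of `WindowData.hol` with the same constant (`0 < β`). -/
theorem hol_axis_of_pair (h : WindowData L z β D b) (hβ : 0 < β) {μ ν ρ : Fin d} {x : Site d} {m : ℕ}
    (hx : StencilIn L z μ ν x) (hxm : StencilIn L z μ ν (x + m • e ρ)) :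
    ‖fdiff D μ (x + m • e ρ) ν - fdiff D μ x ν‖ ≤ b.hol * (m : ℝ) ^ β :=
  axis_of_pairs (fun y => fdiff D μ y ν) (StencilIn L z μ ν) hβ (fun _ _ hy hy' => hol_pair h hy hy') x ρ m hx hxm

end Holder

/-! ## §5  General pairs for the gradient slot: Lipschitz in the contour length, and the interpolated Hölder
reading of the field itself -/

section Gradient

variable {L : ℕ} {z : Site d} {β : ℝ} {D : Fld d R} {b : Win}

/-- [folklore] TELESCOPING ALONG AN AXIS: if the bonds `⟨y, y+e_ν⟩` and `⟨y + m·e_μ, y + m·e_μ + e_ν⟩` are interior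
then `‖D(y + m·e_μ;ν) − D(y;ν)‖ ≤ b₁·m` (`m` first differences, each an instance of `WindowData.grad` at an interior
stencil, interior by `bondIn_add_nsmul_of_le`). -/
theorem grad_leg (h : WindowData L z β D b) {ν μ : Fin d} {y : Site d} (m : ℕ) (hy : BondIn L z ν y)
    (hym : BondIn L z ν (y + m • e μ)) : ‖D (y + m • e μ) ν - D y ν‖ ≤ b.grad * m := by
  have key : ∀ i ≤ m, ‖D (y + i • e μ) ν - D y ν‖ ≤ b.grad * i := by
    intro i
    induction i with
    | zero => intro _; simp
    | succ i ih =>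
      intro hi
      have hB : BondIn L z ν (y + i • e μ) := bondIn_add_nsmul_of_le hy hym (Nat.le_of_succ_le hi)
      have hB' : BondIn L z ν (y + i • e μ + e μ) := by
        rw [← add_succ_nsmul]; exact bondIn_add_nsmul_of_le hy hym hi
      have hstep : ‖D (y + (i + 1) • e μ) ν - D (y + i • e μ) ν‖ ≤ b.grad := by
        rw [add_succ_nsmul]
        exact h.grad μ ν (y + i • e μ) hB.1 hB'.1 hB'.2
      calc ‖D (y + (i + 1) • e μ) ν - D y ν‖
          ≤ ‖D (y + (i + 1) • e μ) ν - D (y + i • e μ) ν‖ + ‖D (y + i • e μ) ν - D y ν‖ :=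
            norm_sub_le_norm_sub_add_norm_sub _ _ _
        _ ≤ b.grad + b.grad * i := add_le_add hstep (ih (Nat.le_of_succ_le hi))
        _ = b.grad * ((i + 1 : ℕ) : ℝ) := by push_cast; ring
  exact key m le_rfl

/-- [folklore] GENERAL PAIRS FOR THE GRADIENT SLOT: for every pair of interior bonds `⟨y,y+e_ν⟩`, `⟨y′,y′+e_ν⟩` of
`B(z)`, `‖D(y′;ν) − D(y;ν)‖ ≤ b₁ · ℓ₁(y,y′)` (staircase lemma with `β = 1`, legs by `grad_leg`). -/
theorem grad_pair (h : WindowData L z β D b) {ν : Fin d} {y y' : Site d} (hy : BondIn L z ν y)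
    (hy' : BondIn L z ν y') : ‖D y' ν - D y ν‖ ≤ b.grad * ∑ κ, |(y' κ : ℝ) - y κ| := by
  have H := norm_sub_le_of_legs (fun w => D w ν) (BondIn L z ν) (c := b.grad) (β := 1) (bondIn_mix hy hy')
    (fun w ρ m hw hw' => by rw [Real.rpow_one]; exact grad_leg h m hw hw')
  simpa only [Real.rpow_one] using H

/-- [folklore] THE EUCLIDEAN READING for the gradient slot: `‖D(y′;ν) − D(y;ν)‖ ≤ √d · b₁ · ℓ₂(y,y′)` with
`ℓ₂(y,y′) = (Σ_κ (y′_κ − y_κ)²)^{1/2}` (Cauchy–Schwarz = the case `β = 1` of the Euclidean power mean). -/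
theorem grad_pair_l2 (h : WindowData L z β D b) {ν : Fin d} {y y' : Site d} (hy : BondIn L z ν y)
    (hy' : BondIn L z ν y') :
    ‖D y' ν - D y ν‖ ≤ (d : ℝ) ^ (1 / 2 : ℝ) * b.grad * (∑ κ, ((y' κ : ℝ) - y κ) ^ 2) ^ (1 / 2 : ℝ) := by
  refine (grad_pair h hy hy').trans ?_
  have H := sum_abs_rpow_le_card_rpow_mul_sum_sq_rpow (Finset.univ : Finset (Fin d)) (fun κ => (y' κ : ℝ) - y κ)
    zero_le_one one_le_two
  rw [Finset.card_univ, Fintype.card_fin] at H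
  simp only [Real.rpow_one] at H
  have e1 : (1 : ℝ) - 1 / 2 = 1 / 2 := by norm_num
  rw [e1] at H
  calc b.grad * ∑ κ, |(y' κ : ℝ) - y κ|
      ≤ b.grad * ((d : ℝ) ^ (1 / 2 : ℝ) * (∑ κ, ((y' κ : ℝ) - y κ) ^ 2) ^ (1 / 2 : ℝ)) :=
        mul_le_mul_of_nonneg_left H h.grad_nonneg
    _ = (d : ℝ) ^ (1 / 2 : ℝ) * b.grad * (∑ κ, ((y' κ : ℝ) - y κ) ^ 2) ^ (1 / 2 : ℝ) := by ring

/-- [folklore] THE INTERPOLATED HÖLDER READING OF THE FIELD ITSELF on general pairs (plain-difference format of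
print's first Hölder norm `‖A‖_α` of (3.40)): `‖D(y′;ν) − D(y;ν)‖ ≤ min(2b₀, b₁ℓ₁) ≤ (2b₀)^{1−γ}·(b₁·ℓ₁(y,y′))^γ`
for `0 ≤ γ ≤ 1` (`T4RelativeCombGradient.min_le_rpow_mul_rpow`). -/
theorem sup_grad_pair (h : WindowData L z β D b) {γ : ℝ} (hγ0 : 0 ≤ γ) (hγ1 : γ ≤ 1) {ν : Fin d}
    {y y' : Site d} (hy : BondIn L z ν y) (hy' : BondIn L z ν y') :
    ‖D y' ν - D y ν‖ ≤ (2 * b.sup) ^ (1 - γ) * (b.grad * ∑ κ, |(y' κ : ℝ) - y κ|) ^ γ := by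
  have h1 : ‖D y' ν - D y ν‖ ≤ 2 * b.sup := (norm_sub_le _ _).trans (by linarith [h.sup y' ν, h.sup y ν])
  have h2 := grad_pair h hy hy'
  exact (le_min h1 h2).trans (min_le_rpow_mul_rpow (by linarith [h.sup_nonneg])
    (mul_nonneg h.grad_nonneg (Finset.sum_nonneg fun _ _ => abs_nonneg _)) hγ0 hγ1)

end Gradient

/-! ## §6  Non-vacuity -/

section Witness

/-- Non-vacuity of `hol_pair`: the zero field with window `(0,0,0)` (`windowData_zero`) between two copies of the
corner stencil (`3 ≤ L`); the bound reads `≤ 0 · Σ`. -/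
example {L : ℕ} (hL : 3 ≤ L) (z : Site d) (β : ℝ) (μ ν : Fin d) :
    ‖fdiff (fun _ _ => (0 : R)) μ z ν - fdiff (fun _ _ => (0 : R)) μ z ν‖ ≤
      (⟨0, 0, 0⟩ : Win).hol * ∑ κ, |(z κ : ℝ) - z κ| ^ β :=
  hol_pair (windowData_zero L z β) (stencilIn_corner hL z μ ν) (stencilIn_corner hL z μ ν)

/-- Non-vacuity of `grad_pair`: the zero field, window `(0,0,0)` with `β = 0`, `L = 2`, the corner bond twice. -/
example (z : Site d) (ν : Fin d) :
    ‖(fun _ _ => (0 : R)) z ν - (fun _ _ => (0 : R)) z ν‖ ≤ (⟨0, 0, 0⟩ : Win).grad * ∑ κ, |(z κ : ℝ) - z κ| :=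
  grad_pair (β := 0) (windowData_zero 2 z 0) (bondIn_corner le_rfl z ν) (bondIn_corner le_rfl z ν)

/-- A two-dimensional staircase, computed: from `x = (0,0)` to `x′ = (2,−3)` the corners are `mix ∅ = (0,0)`,
`mix {0} = (2,0)`, `mix univ = (2,−3)`, and the coordinate sum of `|x′_κ − x_κ|` is `5`. -/
example : mix ({0} : Finset (Fin 2)) (![0, 0] : Site 2) ![2, -3] = ![2, 0] ∧
    ∑ κ : Fin 2, |(((![2, -3] : Site 2) κ : ℤ) : ℝ) - ((![0, 0] : Site 2) κ : ℝ)| = 5 := by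
  refine ⟨?_, ?_⟩
  · ext κ; fin_cases κ <;> simp
  · simp [Fin.sum_univ_two]; norm_num

end Witness

end Literature.MathematicalPhysics.QuantumFieldTheory.Balaban1983to89.T4CombHolderPairs
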